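import Mathlib.RingTheory.DedekindDomain.AdicValuation
import Mathlib.RingTheory.DedekindDomain.Factorization
import Mathlib.Order.Filter.Cofinite
import HarnessLib

/-!
# A nonzero integer is a unit in the local rings `R_(v)` of a Dedekind domain for all but finitely many primes `v`

Topic `Literature/RingTheory/DedekindDomain`, namespace `Literature.RingTheory.DedekindDomain`.  THEOREMS ONLY; no definition, no named fact,
no instance, no notation, no `sorry`.  Cell `hodgecm-mathlib`, P6 «MOD programme», item «units-cofinite» of the ED.-2 census of the sub-line
`Cruxes/HLiu418/Lines/F0_P6a_ModuliDatum.lean` (desk F0P6a-plan (g0), `F0/P6/F0P6a-plan/ED2-CENSUS-P6a.v1.F0P6a-plan-g0.md` §1∕§4: «Units: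
`|Γ| = [Fᵢ:F]`, `|G| = [K:Kc]` are units in `𝒪_{F,(w)}` for all `w` not dividing them — finitely many exceptions»): the binders `_hcard`,
`_hcardΓ : IsUnit ((Nat.card G : ℕ) : valuationSubringAtPrime F w)` of the letters PWCORE ∕ UP ∕ GALQ hold for cofinitely many `w`.
HC_CM is proved only modulo the printed citations until rung 0 closes; nothing here is about HC.

THE MATHEMATICS.  Let `R` be a Dedekind domain with fraction field `K`, `v` a nonzero prime of `R`, and `R_(v) ⊆ K` the localisation of `R` at `v`
(Mathlib `IsDedekindDomain.HeightOneSpectrum.valuationSubringAtPrime K v`, a discrete valuation ring).  An element `r ∈ R` is a unit of `R_(v)` iff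
`r ∉ v` (Mathlib `IsLocalization.AtPrime.isUnit_to_map_iff`), and a nonzero `r` lies in only finitely many `v` (the prime factors of `(r)`, Mathlib
`Ideal.finite_factors`; [Neukirch1999] I (3.3)∕(3.9)).  Hence for `r ≠ 0` — in particular for a nonzero natural number `n` when `R` has characteristic
`0`, e.g. `R = 𝓞 F` — `r` is a unit of `R_(v)` for all but finitely many `v` ([Neukirch1999] I §11, «`a` is a unit at almost all primes»).

MAIN STATEMENTS.  `isUnit_algebraMap_valuationSubringAtPrime_iff`, `eventually_not_mem_asIdeal`,
**`eventually_isUnit_algebraMap_valuationSubringAtPrime`**, **`eventually_isUnit_natCast_valuationSubringAtPrime`**,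
`eventually_isUnit_natCard_valuationSubringAtPrime` (the `_hcard` shape for a finite group), `eventually_isUnit_natCast_and` (two at once).

## References
* [Neukirch1999] J. Neukirch, *Algebraic Number Theory* (1999), Ch. I (3.3), (3.9) (prime factorisation in Dedekind domains), §11 (localisation
  `𝒪_(𝔭)`, units at almost all primes).
-/

set_option autoImplicit false

noncomputable section

open IsDedekindDomain IsDedekindDomain.HeightOneSpectrum Filter

universe u

namespace Literature.RingTheory.DedekindDomain

variable {R : Type u} [CommRing R] [IsDedekindDomain R] {K : Type u} [Field K] [Algebra R K] [IsFractionRing R K]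

/-- **Units of `R_(v)` coming from `R`**: `r ∈ R` is a unit in the localisation `R_(v) ⊆ K` iff `r ∉ v`.
[cite: Neukirch1999, Ch. I §11 (the local ring `𝒪_(𝔭)`, its units)] -/
theorem isUnit_algebraMap_valuationSubringAtPrime_iff (v : HeightOneSpectrum R) (r : R) :
    IsUnit (algebraMap R (valuationSubringAtPrime K v) r) ↔ r ∉ v.asIdeal :=
  IsLocalization.AtPrime.isUnit_to_map_iff (valuationSubringAtPrime K v) v.asIdeal r

/-- Cofinitely many primes avoid a nonzero element. [cite: Neukirch1999, Ch. I (3.3) and (3.9)] -/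
theorem eventually_not_mem_asIdeal {r : R} (hr : r ≠ 0) : ∀ᶠ v : HeightOneSpectrum R in cofinite, r ∉ v.asIdeal := by
  -- the exceptional set is the set of prime factors of `(r)` (Mathlib `Ideal.finite_factors`; the tree's
  -- `Literature.NumberTheory.GaloisCohomology.finite_setOf_mem_asIdeal_of_ne_zero` states the same finiteness)
  have hI : Ideal.span {r} ≠ ⊥ := by simpa [Ideal.span_singleton_eq_bot] using hr
  rw [Filter.eventually_cofinite]
  refine (Ideal.finite_factors hI).subset fun v hv => ?_
  exact (Ideal.dvd_span_singleton).mpr (by simpa only [Set.mem_setOf_eq, not_not] using hv)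

variable (K) in
/-- **A nonzero `r ∈ R` is a unit of `R_(v)` for all but finitely many primes `v`.** [cite: Neukirch1999, Ch. I §11 (units at almost all primes)] -/
theorem eventually_isUnit_algebraMap_valuationSubringAtPrime {r : R} (hr : r ≠ 0) :
    ∀ᶠ v : HeightOneSpectrum R in cofinite, IsUnit (algebraMap R (valuationSubringAtPrime K v) r) := by
  filter_upwards [eventually_not_mem_asIdeal hr] with v hv
  exact (isUnit_algebraMap_valuationSubringAtPrime_iff v r).mpr hv

variable (R K) in
/-- **A nonzero natural number is a unit of `R_(v)` for all but finitely many primes `v`** of a Dedekind domain of characteristic zero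
(`n = algebraMap R R_(v) (n : R)` and `(n : R) ≠ 0`). [cite: Neukirch1999, Ch. I §11 (units at almost all primes)] -/
theorem eventually_isUnit_natCast_valuationSubringAtPrime [CharZero R] {n : ℕ} (hn : n ≠ 0) :
    ∀ᶠ v : HeightOneSpectrum R in cofinite, IsUnit ((n : ℕ) : valuationSubringAtPrime K v) := by
  have hr : (n : R) ≠ 0 := Nat.cast_ne_zero.mpr hn
  filter_upwards [eventually_isUnit_algebraMap_valuationSubringAtPrime K hr] with v hv
  rwa [map_natCast] at hv

variable (R K) in
/-- **The `_hcard` shape**: for a finite group (indeed any nonempty finite type) `G`, `|G|` is a unit of `R_(v)` for all but finitely many `v`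
(`R` of characteristic zero). [cite: Neukirch1999, Ch. I §11 (units at almost all primes)] -/
theorem eventually_isUnit_natCard_valuationSubringAtPrime [CharZero R] (G : Type*) [Finite G] [Nonempty G] :
    ∀ᶠ v : HeightOneSpectrum R in cofinite, IsUnit ((Nat.card G : ℕ) : valuationSubringAtPrime K v) :=
  eventually_isUnit_natCast_valuationSubringAtPrime R K (Nat.card_pos (α := G)).ne'

variable (R K) in
/-- Two nonzero natural numbers are simultaneously units of `R_(v)` for all but finitely many `v` (intersection of two cofinite sets; the
form in which the letters UP ∕ PWCORE consume `_hcard` and `_hcardΓ` together). [cite: Neukirch1999, Ch. I §11 (units at almost all primes)] -/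
theorem eventually_isUnit_natCast_and [CharZero R] {m n : ℕ} (hm : m ≠ 0) (hn : n ≠ 0) :
    ∀ᶠ v : HeightOneSpectrum R in cofinite,
      IsUnit ((m : ℕ) : valuationSubringAtPrime K v) ∧ IsUnit ((n : ℕ) : valuationSubringAtPrime K v) :=
  (eventually_isUnit_natCast_valuationSubringAtPrime R K hm).and (eventually_isUnit_natCast_valuationSubringAtPrime R K hn)

/-- The exceptional set is finite: `{v | n is not a unit of R_(v)}` is finite for `n ≠ 0` (`R` of characteristic zero) — the form in which a
finite bad set `S₃ ⊇ {w ∣ n}` is assembled. [cite: Neukirch1999, Ch. I §11 (units at almost all primes)] -/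
theorem finite_setOf_not_isUnit_natCast_valuationSubringAtPrime [CharZero R] {n : ℕ} (hn : n ≠ 0) :
    {v : HeightOneSpectrum R | ¬ IsUnit ((n : ℕ) : valuationSubringAtPrime K v)}.Finite := by
  have h := eventually_isUnit_natCast_valuationSubringAtPrime R K hn
  rwa [Filter.eventually_cofinite] at h

end Literature.RingTheory.DedekindDomain

end
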